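import Mathlib
import Summits.KontsevichZagierPeriods.Zeta5Search.LemmaDBonusTypes
import Summits.KontsevichZagierPeriods.Zeta5Search.PalindromicClassBoundsProof
import HarnessLib

/-!
# ζ(5) search — THEOREM LB♯♯ (`LemmaDBonus`, gen-2 g8 REPORT §3.9 / g9 §1.7) is a THEOREM (part 2 of 2)

Cell `pub-zeta5` (HONEST FRAMING: systematic search; no irrationality claim unless certified), typer seat generation 10.
Discharges BY NAME `LemmaDBonus` (`Zeta5Search/LemmaDBonus.lean`; census rung S): in the window, for `p ≤ d`, if the multipole minimum `m`
of the class exponents is attained, every single-pole class has `ν > m` (and `m ≤ −3`), and the non-dropped minimal multipole classes are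
pairwise of the same type (same centre flag, exponent vectors equal up to reversal), then `v_p(Cas_j(b)) ≥ casLB + 1`.

PROOF.  This is the through-the-origin case of the collinearity criterion `collinearityCriterionT_holds` (typer g10) with `N = −m`:
* §1 `m ≤ −3` ALWAYS holds under the hypotheses: the degree count `Σ_{x<p} E_x = −(2d+5) < −2p` (`sum_classExp_val`) produces a class with
  `E_x ≤ −3` (`exists_classExp_le_of_mul_lt`, PalindromicClassBoundsProof); it is a single-pole class (then the hypothesis gives `m ≤ −3`) or a multipole class (then `m ≤ E_x ≤ −3`).  So the statement's
  placement of `m ≤ −3` inside the single-pole hypothesis loses nothing.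
* regime T: a class below `m` is neither pole-free (`E ≥ 0`) nor multipole (`E ≥ m`), hence single-pole, and `ν > m ≥ E` forces tameness.
* the orbit vectors of the depth-`N` classes lie on a line through the origin (§2): a deep single-pole class and its conjugate are tame, so
  `σ_K = 0` and `v̄ = 0` (`cast_vHat_eq_zero_of_classNu_nonneg`); a DROPPED pair (centre-free, palindromic vector, even exponent) has `ĉ_x = 0`
  (the conjugate has the same type, hence the same `ĉ`, while `CHatReversal` gives `ĉ_x̄ = −ĉ_x`) and `v̂_x̄ = v̂_x`, so with
  `s = (−1)^{N+1} = −1` its orbit vector vanishes; two NON-DROPPED minimal multipole classes of the same type have equal orbit vectors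
  (equal exponent vectors: equal type data for them and for their conjugates, `typeData_eq`) or opposite ones up to the factor `s`
  (reversed vectors: `y` has the data of `x̄₀` and `ȳ` those of `x₀`; `s² = 1`); two self-conjugate classes coincide.  Hence all orbit
  vectors are `0`, `P₀` or `sP₀`, and `(a, c) = (V₀, −K₀)` (or `(1, 0)` if `P₀ = 0`) is the required line with `e = 0`.
`p`-adic valuations of rational numbers; nothing here bears on irrationality.
-/

noncomputable section

open Finset

namespace Summit.KontsevichZagierPeriods.Zeta5Search.ClusterValuation

open Summit.KontsevichZagierPeriods.Zeta5Search.DualSeries (InBox)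
open Summit.KontsevichZagierPeriods.Zeta5Search.WedgeDictionary (dOf)
open Summit.KontsevichZagierPeriods.Zeta5Search.CasoratianValuation (InPolytope shift casoratian)
open Summit.KontsevichZagierPeriods.Zeta5Search.PadicSeries
open Summit.KontsevichZagierPeriods.Zeta5Search.CellKit (conj_level netExp_conj_level)

variable {p : ℕ} [hp : Fact p.Prime]

/-! ## §1  The multipole minimum is at most `−3` -/

/-- **Some class has exponent `≤ −3`** as soon as `p ≤ d(b)`: the degree count `Σ_{x<p} E_x = −(2d+5) < −2p`. -/
theorem exists_classExp_le_neg_three (b : ℕ → ℤ) (hb : InPolytope b) (hp5 : 5 ≤ p) (hpd : (p : ℤ) ≤ dOf b) :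
    ∃ x, x < p ∧ classExp b p x ≤ -3 := by
  obtain ⟨x, hx, hE⟩ := exists_classExp_le_of_mul_lt b hb hp5 2 (by push_cast; omega)
  exact ⟨x, hx, by omega⟩

/-- Under the hypotheses of `LemmaDBonus` the multipole minimum `m` is at most `−3`. -/
theorem multipoleMin_le_neg_three (b : ℕ → ℤ) {m : ℤ} (hb : InPolytope b) (hp5 : 5 ≤ p) (hpd : (p : ℤ) ≤ dOf b)
    (hminle : ∀ x ∈ multipoleClasses b p, m ≤ classExp b p x)
    (hsingle : ∀ y, y < p → classPoleCount b p y = 1 → m ≤ -3 ∧ m < classNu b p y) : m ≤ -3 := by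
  obtain ⟨x, hx, hE⟩ := exists_classExp_le_neg_three b hb hp5 hpd
  rcases Nat.lt_trichotomy (classPoleCount b p x) 1 with h0 | h1 | h2
  · have := classExp_nonneg_of_noPole b (by omega : classPoleCount b p x = 0); omega
  · exact (hsingle x hx h1).1
  · exact (hminle x (mem_filter.2 ⟨mem_range.2 hx, by omega⟩)).trans hE

/-- Two residues `x, y < p` whose classes both contain the centre coincide (`p` odd). -/
theorem eq_of_centreIn (b : ℕ → ℤ) (hp5 : 5 ≤ p) {x y : ℕ} (hx : x < p) (hy : y < p)
    (hcx : CentreIn b p x) (hcy : CentreIn b p y) : x = y := by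
  unfold CentreIn at hcx hcy
  have hd : (p : ℤ) ∣ 2 * ((x : ℤ) - y) := by
    have h := hcx.sub hcy
    have e : 2 * (x : ℤ) - b 0 - (2 * y - b 0) = 2 * ((x : ℤ) - y) := by ring
    rwa [e] at h
  rcases (Nat.prime_iff_prime_int.1 hp.out).dvd_or_dvd hd with h2 | hxy
  · have := Int.le_of_dvd two_pos h2; omega
  · have h0 := Int.eq_zero_of_dvd_of_natAbs_lt_natAbs hxy (by omega)
    omega

omit hp in
/-- A residue `x < p ≤ b₀` is a level class for some `L`. -/
theorem exists_level (b : ℕ → ℤ) {x : ℕ} (hp0 : 0 < p) (hxn : x ≤ (b 0).toNat) :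
    ∃ L, x + L * p ≤ (b 0).toNat ∧ (b 0).toNat < x + L * p + p :=
  ⟨_, level_bounds b hp0 hxn⟩

/-! ## §2  `LemmaDBonus` -/

/-- **`LemmaDBonus` (THEOREM LB♯♯) is a theorem.** -/
theorem lemmaDBonus_holds : LemmaDBonus := by
  intro b j p m hb hj1 hj7 hb' hprime hp5 hpb hpd hwin hmin hminle hsingle htype hcas
  haveI : Fact p.Prime := ⟨hprime⟩
  classical
  have hp0 : 0 < p := hprime.pos
  have hbox : InBox b := hb.1
  have h0 : 0 ≤ b 0 := hbox.1
  set n := (b 0).toNat with hn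
  have hnZ : ((n : ℕ) : ℤ) = b 0 := Int.toNat_of_nonneg h0
  have hpn : p ≤ n := by omega
  obtain ⟨-, -, -, hnp2⟩ := thmA_data b hb hwin
  have hp2 : p ≠ 2 := by omega
  -- `m ≤ −3`; `N := −m`
  have hm3 : m ≤ -3 := multipoleMin_le_neg_three b hb hp5 hpd hminle hsingle
  obtain ⟨N, hNm⟩ : ∃ N : ℕ, (N : ℤ) = -m := ⟨(-m).toNat, by omega⟩
  have hN : 3 ≤ N := by omega
  have hmN : m = -(N : ℤ) := by omega
  -- tameness at and below the minimum
  have htame : ∀ x, x < p → classPoleCount b p x = 1 → classExp b p x ≤ m →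
      tameSingle b p x = true ∧ 0 ≤ classNu b p x := by
    intro x hx h1 hE
    have hnu := (hsingle x hx h1).2
    by_cases ht : tameSingle b p x = true
    · exact ⟨ht, by unfold classNu; rw [if_pos ⟨h1, ht⟩]; exact le_max_right _ _⟩
    · exfalso
      have : classNu b p x = classExp b p x := by unfold classNu; rw [if_neg (fun h => ht h.2)]
      omega
  have hT : ∀ x, x < p → classExp b p x < -(N : ℤ) → classPoleCount b p x = 1 ∧ tameSingle b p x = true := by
    intro x hx hlt
    have h1 : classPoleCount b p x = 1 := by
      rcases Nat.lt_trichotomy (classPoleCount b p x) 1 with hc0 | hc1 | hc2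
      · have := classExp_nonneg_of_noPole b (by omega : classPoleCount b p x = 0); omega
      · exact hc1
      · have := hminle x (mem_filter.2 ⟨mem_range.2 hx, by omega⟩); omega
    exact ⟨h1, (htame x hx h1 (by omega)).1⟩
  have hM : ∃ x ∈ multipoleClasses b p, classExp b p x = -(N : ℤ) := by
    obtain ⟨x, hx, hE⟩ := hmin
    exact ⟨x, hx, by rw [hE, hmN]⟩
  have hTb : ∀ x, x < p → 1 ≤ classPoleCount b p x → classExp b p x < -(N : ℤ) →
      classPoleCount b p x = 1 ∧ 0 ≤ classNu b p x := by
    intro x hx _ hlt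
    obtain ⟨h1, -⟩ := hT x hx hlt
    exact ⟨h1, (htame x hx h1 (by omega)).2⟩
  set D := deepClasses b p N with hD
  have hsel : ∀ x ∈ D, classExp b p x = -(N : ℤ) := fun x hx => (mem_filter.1 hx).2
  have hnsel : ∀ x, x < p → x ∉ D → classExp b p x = -(N : ℤ) → 1 ≤ classPoleCount b p x →
      classPoleCount b p x = 1 ∧ 0 ≤ classNu b p x :=
    fun x hx hxD hE _ => absurd (mem_filter.2 ⟨mem_range.2 hx, hE⟩) hxD
  -- the orbit vectors in `ZMod p`
  set s : ZMod p := (-1 : ZMod p) ^ (N + 1) with hs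
  set KF : ℕ → ZMod p := fun x => ((orbitK b p N x : ℚ) : ZMod p) with hKF
  set VF : ℕ → ZMod p := fun x => ((orbitV b p N x : ℚ) : ZMod p) with hVF
  have hss : s * s = 1 := by
    simp only [hs]; rw [← pow_add]; exact Even.neg_one_pow ⟨N + 1, rfl⟩
  -- (A) deep classes that are not non-dropped multipole classes have orbit vector `0`
  have hA : ∀ x ∈ D, ¬ (2 ≤ classPoleCount b p x ∧ droppedPair b p x = false) → KF x = 0 ∧ VF x = 0 := by
    intro x hxD hnot
    obtain ⟨hxr, hE⟩ := mem_filter.1 hxD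
    have hx := mem_range.1 hxr
    have hxn : x ≤ n := by omega
    have hpos : 1 ≤ classPoleCount b p x := by
      by_contra h0'
      have := classExp_nonneg_of_noPole b (by omega : classPoleCount b p x = 0); omega
    have hcx_mem : conjClass b p x ∈ D := conjClass_mem_deepClasses b hb hpn hxD
    have hc_lt : conjClass b p x < p := conjClass_lt b hp0 x
    have hcE : classExp b p (conjClass b p x) = -(N : ℤ) := hsel _ hcx_mem
    have hcnt : classPoleCount b p (conjClass b p x) = classPoleCount b p x := classPoleCount_conj b h0 hxn
    by_cases hmulti : 2 ≤ classPoleCount b p x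
    · -- a dropped pair
      have hdrop : droppedPair b p x = true := by
        by_contra hd
        exact hnot ⟨hmulti, by simpa using hd⟩
      unfold droppedPair at hdrop
      obtain ⟨hcx, hpalv, heven⟩ := of_decide_eq_true hdrop
      obtain ⟨L, hL, hL'⟩ := exists_level b hp0 hxn
      have hev := expVector_level b hx hL hL'
      have hpal : ∀ k ≤ L, netExp b (x + k * p) = netExp b (x + (L - k) * p) := by
        have h := hpalv
        rw [hev, map_range_reverse] at h
        exact (levelData_of_map_eq h).2
      obtain ⟨hx', hM, hM'⟩ := conj_level b hx hL hL'
      have hcc : ¬ CentreIn b p (conjClass b p x) := fun h => hcx ((centreIn_conj_iff b h0 hxn).1 h)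
      have hex : ∀ k ≤ L, netExp b (conjClass b p x + k * p) = netExp b (x + k * p) := by
        intro k hk
        rw [netExp_conj_level b hL hL' h0 hk, ← hpal k hk]
      obtain ⟨hc_eq, hv_eq, hn_eq, -⟩ := typeData_eq b hx' hM hM' hx hL hL' hcc hcx hex
      have hrev := cHatReversal_holds b p x hb hprime hp5 hwin hx (by omega) hcx
      have hsign : (-1 : ℚ) ^ (classExp b p x + 1) = -1 := by
        obtain ⟨k, hk⟩ := heven
        exact Odd.neg_one_zpow ⟨k, by rw [hk]; ring⟩
      rw [hsign, hc_eq] at hrev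
      have hc0 : cHat b p x = 0 := by linarith
      have hK0 : sigmaK b p x = 0 := by unfold sigmaK; rw [if_pos hmulti, hc0]
      have hK0' : sigmaK b p (conjClass b p x) = 0 := by rw [sigmaK_eq_of_typeData hc_eq hn_eq]; exact hK0
      have hs1 : s = -1 := by
        have hNe : Even N := by
          have : Even (-(classExp b p x)) := heven.neg
          rw [hE, neg_neg] at this
          exact (Int.even_coe_nat N).1 this
        simp only [hs]
        exact Odd.neg_one_pow (hNe.add_one)
      constructor
      · simp only [hKF]
        rw [cast_orbitK b h0 hnp2 hp2 N x, if_neg hcx, hK0, hK0', Rat.cast_zero, mul_zero, add_zero]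
      · simp only [hVF]
        rw [cast_orbitV b h0 hnp2 hp2 N x, if_neg hcx, hv_eq, ← hs, hs1]
        ring
    · -- a tame single-pole class, with tame conjugate
      have h1 : classPoleCount b p x = 1 := by omega
      obtain ⟨-, hnu⟩ := htame x hx h1 (by omega)
      have h1c : classPoleCount b p (conjClass b p x) = 1 := by rw [hcnt]; exact h1
      obtain ⟨-, hnuc⟩ := htame _ hc_lt h1c (by omega)
      have hK0 : sigmaK b p x = 0 := sigmaK_eq_zero_of_le_one b (by omega)
      have hK0' : sigmaK b p (conjClass b p x) = 0 := sigmaK_eq_zero_of_le_one b (by omega)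
      have hv0 := cast_vHat_eq_zero_of_classNu_nonneg b hb hp5 hwin hN hTb D hsel hnsel hx hxD hpos hnu
      have hv0' := cast_vHat_eq_zero_of_classNu_nonneg b hb hp5 hwin hN hTb D hsel hnsel hc_lt hcx_mem (by omega) hnuc
      constructor
      · simp only [hKF]
        rw [cast_orbitK b h0 hnp2 hp2 N x, hK0, hK0', Rat.cast_zero]
        split_ifs <;> ring
      · simp only [hVF]
        rw [cast_orbitV b h0 hnp2 hp2 N x, hv0, hv0']
        split_ifs <;> ring
  -- (B) two non-dropped minimal multipole classes have equal orbit vectors, up to the sign `s`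
  have hB : ∀ x₀ ∈ D, ∀ y ∈ D, 2 ≤ classPoleCount b p x₀ → droppedPair b p x₀ = false →
      2 ≤ classPoleCount b p y → droppedPair b p y = false →
      (KF y = KF x₀ ∧ VF y = VF x₀) ∨ (KF y = s * KF x₀ ∧ VF y = s * VF x₀) := by
    intro x₀ hx₀D y hyD hmx hdx hmy hdy
    obtain ⟨hx₀r, hEx⟩ := mem_filter.1 hx₀D
    obtain ⟨hyr, hEy⟩ := mem_filter.1 hyD
    have hx₀ := mem_range.1 hx₀r
    have hy := mem_range.1 hyr
    have hx₀n : x₀ ≤ n := by omega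
    have hyn : y ≤ n := by omega
    have hst := htype x₀ (mem_filter.2 ⟨hx₀r, hmx⟩) y (mem_filter.2 ⟨hyr, hmy⟩)
      (by rw [hEx, hmN]) (by rw [hEy, hmN]) hdx hdy
    unfold sameType at hst
    obtain ⟨hciff, hvec⟩ := of_decide_eq_true hst
    by_cases hc : CentreIn b p x₀
    · have hxy : y = x₀ := eq_of_centreIn b hp5 hy hx₀ (hciff.1 hc) hc
      subst hxy
      exact Or.inl ⟨rfl, rfl⟩
    · have hcy : ¬ CentreIn b p y := fun h => hc (hciff.2 h)
      obtain ⟨L, hL, hL'⟩ := exists_level b hp0 hx₀n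
      obtain ⟨L', hLy, hLy'⟩ := exists_level b hp0 hyn
      have hevx := expVector_level b hx₀ hL hL'
      have hevy := expVector_level b hy hLy hLy'
      obtain ⟨hx₀', hLc, hLc'⟩ := conj_level b hx₀ hL hL'
      have hccx : ¬ CentreIn b p (conjClass b p x₀) := fun h => hc ((centreIn_conj_iff b h0 hx₀n).1 h)
      have hccy : ¬ CentreIn b p (conjClass b p y) := fun h => hcy ((centreIn_conj_iff b h0 hyn).1 h)
      rcases hvec with hsame | hrevd
      · -- equal exponent vectors
        rw [hevx, hevy] at hsame
        obtain ⟨hLL, he⟩ := levelData_of_map_eq hsame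
        subst hLL
        obtain ⟨hy', hLyc, hLyc'⟩ := conj_level b hy hLy hLy'
        obtain ⟨hc1, hv1, hn1, -⟩ := typeData_eq b hx₀ hL hL' hy hLy hLy' hc hcy he
        have hec : ∀ k ≤ L, netExp b (conjClass b p x₀ + k * p) = netExp b (conjClass b p y + k * p) := by
          intro k hk
          rw [netExp_conj_level b hL hL' h0 hk, netExp_conj_level b hLy hLy' h0 hk, he (L - k) (Nat.sub_le _ _)]
        obtain ⟨hc2, hv2, hn2, -⟩ := typeData_eq b hx₀' hLc hLc' hy' hLyc hLyc' hccx hccy hec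
        left
        constructor
        · simp only [hKF]
          rw [cast_orbitK b h0 hnp2 hp2 N y, cast_orbitK b h0 hnp2 hp2 N x₀, if_neg hcy, if_neg hc,
            sigmaK_eq_of_typeData hc1 hn1, sigmaK_eq_of_typeData hc2 hn2]
        · simp only [hVF]
          rw [cast_orbitV b h0 hnp2 hp2 N y, cast_orbitV b h0 hnp2 hp2 N x₀, if_neg hcy, if_neg hc, hv1, hv2]
      · -- reversed exponent vectors: `y` carries the data of `x̄₀`, and `ȳ` those of `x₀`
        rw [hevx, hevy, map_range_reverse] at hrevd
        obtain ⟨hLL, he⟩ := levelData_of_map_eq hrevd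
        subst hLL
        obtain ⟨hy', hLyc, hLyc'⟩ := conj_level b hy hLy hLy'
        have he1 : ∀ k ≤ L, netExp b (x₀ + k * p) = netExp b (conjClass b p y + k * p) := by
          intro k hk
          rw [netExp_conj_level b hLy hLy' h0 hk, he k hk]
        obtain ⟨hc1, hv1, hn1, -⟩ := typeData_eq b hx₀ hL hL' hy' hLyc hLyc' hc hccy he1
        have he2 : ∀ k ≤ L, netExp b (conjClass b p x₀ + k * p) = netExp b (y + k * p) := by
          intro k hk
          rw [netExp_conj_level b hL hL' h0 hk, he (L - k) (Nat.sub_le _ _), Nat.sub_sub_self hk]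
        obtain ⟨hc2, hv2, hn2, -⟩ := typeData_eq b hx₀' hLc hLc' hy hLy hLy' hccx hcy he2
        right
        constructor
        · simp only [hKF]
          rw [cast_orbitK b h0 hnp2 hp2 N y, cast_orbitK b h0 hnp2 hp2 N x₀, if_neg hcy, if_neg hc,
            ← sigmaK_eq_of_typeData hc2 hn2, ← sigmaK_eq_of_typeData hc1 hn1, ← hs]
          linear_combination (-(((sigmaK b p (conjClass b p x₀) : ℚ) : ZMod p))) * hss
        · simp only [hVF]
          rw [cast_orbitV b h0 hnp2 hp2 N y, cast_orbitV b h0 hnp2 hp2 N x₀, if_neg hcy, if_neg hc, ← hv2, ← hv1, ← hs]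
          linear_combination (-(((vHat b p (conjClass b p x₀) : ℚ) : ZMod p))) * hss
  -- integrality of the line relation, and its reading in `ZMod p`
  have hrel : ∀ (a c : ℤ) (x : ℕ), (a : ZMod p) * KF x + (c : ZMod p) * VF x = 0 →
      pCong p (a * orbitK b p N x + c * orbitV b p N x + ((0 : ℤ) : ℚ)) = true := by
    intro a c x h
    have hdK := den_orbitK b h0 hnp2 hp2 N x
    have hdV := den_orbitV b h0 hnp2 hp2 N x
    have hden : ¬ p ∣ ((a : ℚ) * orbitK b p N x + c * orbitV b p N x + ((0 : ℤ) : ℚ)).den :=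
      PInt.add (PInt.add (PInt.mul (PInt.intCast a) hdK) (PInt.mul (PInt.intCast c) hdV)) (PInt.intCast 0)
    refine PInt.pCong_of_cast_eq_zero hden ?_
    rw [PInt.cast_add (PInt.add (PInt.mul (PInt.intCast a) hdK) (PInt.mul (PInt.intCast c) hdV)) (PInt.intCast 0),
      PInt.cast_add (PInt.mul (PInt.intCast a) hdK) (PInt.mul (PInt.intCast c) hdV),
      PInt.cast_mul (PInt.intCast a) hdK, PInt.cast_mul (PInt.intCast c) hdV, Rat.cast_intCast, Rat.cast_intCast,
      Rat.cast_intCast, Int.cast_zero, add_zero]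
    exact h
  have hone : ¬ ((p : ℤ) ∣ 1) := fun h => by have := Int.le_of_dvd one_pos h; omega
  -- the line through the origin
  have hline : ∃ a c e : ℤ, ¬ ((p : ℤ) ∣ a ∧ (p : ℤ) ∣ c) ∧
      (e = 0 ∨ (pCong p (∑ x ∈ deepClasses b p N, gHat b p x) = true ∧
        pCong p (∑ x ∈ deepClasses b p N, ((b j : ℚ) - x) * ((b 0 - b j : ℚ) - x) * gHat b p x) = true)) ∧
      ∀ x ∈ deepClasses b p N, pCong p (a * orbitK b p N x + c * orbitV b p N x + e) = true := by
    by_cases hND : ∃ x₀ ∈ D, 2 ≤ classPoleCount b p x₀ ∧ droppedPair b p x₀ = false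
    · obtain ⟨x₀, hx₀D, hmx, hdx⟩ := hND
      have hall : ∀ x ∈ D, (KF x = 0 ∧ VF x = 0) ∨ (KF x = KF x₀ ∧ VF x = VF x₀) ∨
          (KF x = s * KF x₀ ∧ VF x = s * VF x₀) := by
        intro x hxD
        by_cases hx' : 2 ≤ classPoleCount b p x ∧ droppedPair b p x = false
        · exact Or.inr (hB x₀ hx₀D x hxD hmx hdx hx'.1 hx'.2)
        · exact Or.inl (hA x hxD hx')
      by_cases hz : KF x₀ = 0 ∧ VF x₀ = 0
      · refine ⟨1, 0, 0, fun h => hone h.1, Or.inl rfl, fun x hxD => ?_⟩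
        have := hrel 1 0 x ?_
        · simpa using this
        · rcases hall x hxD with ⟨hk, -⟩ | ⟨hk, -⟩ | ⟨hk, -⟩ <;> rw [hk] <;> simp [hz.1]
      · refine ⟨((VF x₀).val : ℤ), -(((KF x₀).val : ℕ) : ℤ), 0, fun h => hz ?_, Or.inl rfl, fun x hxD => ?_⟩
        · obtain ⟨h1, h2⟩ := h
          have e1 : ((((VF x₀).val : ℕ) : ℤ) : ZMod p) = VF x₀ := by rw [Int.cast_natCast, ZMod.natCast_zmod_val]
          have e2 : ((((KF x₀).val : ℕ) : ℤ) : ZMod p) = KF x₀ := by rw [Int.cast_natCast, ZMod.natCast_zmod_val]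
          refine ⟨?_, ?_⟩
          · rw [← e2]; exact (ZMod.intCast_zmod_eq_zero_iff_dvd _ _).2 ((dvd_neg).1 h2)
          · rw [← e1]; exact (ZMod.intCast_zmod_eq_zero_iff_dvd _ _).2 h1
        · have := hrel ((VF x₀).val : ℤ) (-(((KF x₀).val : ℕ) : ℤ)) x ?_
          · simpa using this
          · have e1 : ((((VF x₀).val : ℕ) : ℤ) : ZMod p) = VF x₀ := by rw [Int.cast_natCast, ZMod.natCast_zmod_val]
            have e2 : (((-(((KF x₀).val : ℕ) : ℤ) : ℤ)) : ZMod p) = -KF x₀ := by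
              rw [Int.cast_neg, Int.cast_natCast, ZMod.natCast_zmod_val]
            rw [e1, e2]
            rcases hall x hxD with ⟨hk, hv⟩ | ⟨hk, hv⟩ | ⟨hk, hv⟩ <;> rw [hk, hv] <;> ring
    · push Not at hND
      refine ⟨1, 0, 0, fun h => hone h.1, Or.inl rfl, fun x hxD => ?_⟩
      have hx0 := hA x hxD (fun h => hND x hxD h.1 h.2)
      have := hrel 1 0 x (by rw [hx0.1, hx0.2]; simp)
      simpa using this
  exact collinearityCriterionT_holds b p j N hb hb' hj1 hj7 hprime hp5 hpb hpd hwin hN hT hM hline hcas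

end Summit.KontsevichZagierPeriods.Zeta5Search.ClusterValuation

end
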